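import Summits.Ventures.AbcSig.Levels.N2824S1
import Summits.Ventures.AbcSig.Levels.N2824S2

/-!
# Venture AbcSig — GENERATED level file, level 2824 (AGGREGATOR of 2 part files)

HONEST FRAMING. As in the part files `N2824S<i>.lean` (same generator run, same certified level file
`N2824.engine1.json`, sha256 `266d4d49b5b1338c4d682d788eaae5ee2e808b5b8d3569b924a65dc3366d51e5`): this file only concatenates the orbit lists and the part summaries into
`level2824Orbits`, `level2824_wellformed`, `level2824_sieve` (the shapes the row templates consume). The split exists because the
tree's files are ≤ 400 lines. Union of residual exponents ≥ 7: [7]; orbits not eliminable by the sieve: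
none. No Diophantine statement is made here; no claim on ABC or any summit.
-/

namespace Summit.Ventures.AbcSig

/-- All newform orbits of level 2824 (concatenation of the parts, engine order). -/
def level2824Orbits : List OrbitData :=
  level2824OrbitsS1 ++ level2824OrbitsS2

/-- Every listed entry is at an odd prime not dividing 2824. -/
theorem level2824_wellformed :
    ∀ o ∈ level2824Orbits, ∀ e ∈ o.coeffs, e.ell.Prime ∧ e.ell ≠ 2 ∧ ¬ e.ell ∣ 2824 := by
  unfold level2824Orbits
  exact List.forall_mem_append.2 ⟨level2824_wellformedS1, level2824_wellformedS2⟩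

/-- **Level 2824 summary.** For a prime exponent `n ≥ 7`, every orbit of level 2824 is sieve-eliminated by the
kernel certificates of the part files, except that the row's predicate `X` is assumed for: orbit_2824_1 if n ∈ [7], orbit_2824_4 if n ∈ [7]. -/
theorem level2824_sieve (n : ℕ) (hn : n.Prime) (hmin : 7 ≤ n) (X : OrbitData → Prop)
    (h_orbit_2824_1 : n ∈ ([7] : List ℕ) → X orbit_2824_1)
    (h_orbit_2824_4 : n ∈ ([7] : List ℕ) → X orbit_2824_4) :
    ∀ o ∈ level2824Orbits, (∀ e ∈ o.coeffs, e.ell.Prime ∧ e.ell ≠ 2 ∧ ¬ e.ell ∣ 2824) ∧ (o.Eliminated bs04Allowed n ∨ X o) := by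
  unfold level2824Orbits
  exact List.forall_mem_append.2 ⟨(level2824_sieveS1 n hn hmin X h_orbit_2824_1 h_orbit_2824_4), (level2824_sieveS2 n hn hmin X)⟩

end Summit.Ventures.AbcSig
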